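import Literature.MathematicalPhysics.QuantumFieldTheory.Balaban1983to89.B2Eq220CovDerivSplit

/-!
# `Balaban1983to89.B2Ineq222Interaction` — [Balaban1982Higgs2] (2.22) p. 561: the estimate of one interaction term with
the small field `A″` on `Λ₇ᶜ`, `|(D_{B̃^{(1)}}φ)(b)·F₁(−A″_b)φ(b₋)| ≦ c₁p(ε)·O(1)e(ε)p(ε)·λ(ε)^{−1/4}p(ε) = O(ε^{κ₀})` — PROVED
(Cauchy–Schwarz + the ε-bookkeeping `p(ε)³ε^{(4−d)/4} ≦ Cε^{κ₀}` for every `κ₀ < (4−d)/4`), the sequel of this seat's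
`…B2Eq220CovDerivSplit` ((2.20)–(2.21))

statement-level skeleton of published theorems with citation tags; proofs where landed; nothing here is a claim about the Yang–Mills mass gap

PDF held: `paper:balaban1982-cmp86-higgs23-ii` (T. Bałaban, *(Higgs)₂,₃ quantum fields in a finite volume. II. An upper
bound*, Commun. Math. Phys. **86** (1982) 555–594, doi 10.1007/bf01214890; journal page = PDF page + 554); p. 561 [PDF 7]
READ AS AN IMAGE (`run/shared/lean/pub/pub-balaban/b2b-balaban-ref1/pages/1982-cmp86-higgs23-II/…-p007-x2.png`).

CITATION HEADER — WHAT IS REPRODUCED.  SKELETON row **B2.Eq2.42** ((2.20)–(2.42)), member **(2.22)** p. 561 (one of the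
row's «absent residue» estimates per ROWS-B2 v2.16).  Unit `lit-balaban-p15` gen 3 (Phase-2 proof seat p15; HOME
`run/shared/lean/pub/lit-balaban/`, seat dir `lit-balaban-p15/`); B2 fold owner r02, second reader r14; referee ref-4.  Inputs by
name: the cross-paper `LatticeFieldCalculus.covDerivScalar` (r18), `B2LargeField.thrPhi`/`lambdaEps` (the threshold
`p(ε)/λ(ε)^{1/4}` of (2.2)), `B2.pFn`, and this seat's gen-2 `B2Eq220CovDerivSplit.ineq221_printed` (which supplies the
`c₁p(ε)` bound used as the hypothesis `hDB`) and `B2Sect3AGaussianStep.one_add_log_inv_rpow_mul_rpow_le`.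

WHAT IS PRINTED (p. 561 [PDF 7], verbatim).  *"Now let us expand the action with respect to the field A″. This expansion was
described already in Chap. I.3. We use the formulas (I.3.14)–(I.3.16), with B̃^{(1)} instead of B^{(1)}. Let us notice that now
we have worse restrictions on the fields ψ, φ, with the additional factor λ(ε)^{−1/4}, so we have to expand to higher power
than before to compensate for these factors, e.g. we have to take n̄ ≧ 7. After the expansion we get the fundamental quadratic
form for the fields ψ, φ in the external field B̃^{(1)} and the terms describing an interaction with the field A″. We remove
this interaction from the set Λ₇ᶜ, e.g. we estimate
 |(D_{B̃^{(1)}}φ)(b)·F₁(−A″_b)φ(b₋)| ≦ c₁p(ε)O(1)e(ε)p(ε)λ(ε)^{−1/4}p(ε) = O(ε^{κ₀}),   (2.22)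
and similarly the other terms, thus the interaction is estimated by O(ε^{κ₀})|Λ₇ᶜ∩Λ₂|."*  Context (p. 557, p. 560–561):
`p(ε) = b₀(1 + log ε⁻¹)ᵖ`, `λ(ε) = λε^{4−d}`, `e(ε) = eε^{(4−d)/2}`; (2.21) `|(D_{B̃^{(1)}}φ)(b)| ≦ c₁p(ε)`; (2.2)/(2.16)
`|φ(x)| ≦ λ(ε)^{−1/4}p(ε)`; p. 560 `|A″| ≦ O(1)p(ε)` whence the first-order factor `|F₁(−A″_b)| ≦ O(1)e(ε)p(ε)`.

THE MODEL.  `(D_{B̃}φ)(b) = covDerivScalar 1 Urep Bt φ b ∈ W` (prefactor `1` as in the display; `W` a real inner product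
space ↤ ℝ^N), `F₁(−A″_b)` an abstract map `F : W → W` with the printed operator bound (`hF`), `φ(b₋) = φ b.src`; the three
printed bounds are the hypotheses `hDB`, `hF`, `hφ`; the conclusion bounds the real inner product `⟪(D_{B̃}φ)(b), F φ(b₋)⟫`.

WHAT IS KERNEL-CHECKED (zero `sorry`, standard axioms, no definitions).  `ineq222_abstract` (Cauchy–Schwarz with three
bounds), **`ineq222`** (the printed middle expression as the bound), **`scale222_le`** (the ε-bookkeeping: `c₁p(ε)·O₁e(ε)p(ε)·
p(ε)/λ(ε)^{1/4} = c₁O₁(e/λ^{1/4})·p(ε)³ε^{(4−d)/4} ≦ c₁O₁(e/λ^{1/4})b₀³max{1, 3p/((4−d)/4 − κ₀)}^{3p}·ε^{κ₀}` on `(0,1]` for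
`d ≦ 3`, `κ₀ < (4−d)/4`), **`ineq222_printed`** (the whole chain `… ≦ C·ε^{κ₀}` with that explicit `C`).
HONEST SCOPE.  (i) `F₁` and its bound are abstract (the Taylor pieces (I.3.14)–(I.3.16) are not re-derived); (ii) *"similarly the
other terms"* and the count `|Λ₇ᶜ∩Λ₂|` are not typed; (iii) the admissible range `κ₀ < (4−d)/4` is what this product gives — the
paper's `κ₀` is a fixed small positive constant.
-/

noncomputable section

namespace Literature.MathematicalPhysics.QuantumFieldTheory.Balaban1983to89.B2Ineq222Interaction

open LatticeFieldCalculus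
open scoped RealInnerProductSpace

/-! ## §1 (2.22), the product bound -/

section Product

variable {P : Params} {j : ℕ} {W : Type*} [NormedAddCommGroup W] [InnerProductSpace ℝ W]

omit [NormedAddCommGroup W] [InnerProductSpace ℝ W] in
/-- Cauchy–Schwarz with three bounds: `|⟪D, Fv⟫| ≤ ‖D‖·‖Fv‖ ≤ T_D·(T_F·T_φ)`. [folklore]
[cite: Balaban1982Higgs2, (2.22) p.561] -/
theorem ineq222_abstract [NormedAddCommGroup W] [InnerProductSpace ℝ W] {D v : W} (F : W → W) {TD TF Tφ : ℝ}
    (hTF : 0 ≤ TF) (hD : ‖D‖ ≤ TD) (hF : ∀ w : W, ‖F w‖ ≤ TF * ‖w‖) (hv : ‖v‖ ≤ Tφ) :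
    |⟪D, F v⟫| ≤ TD * (TF * Tφ) :=
  (abs_real_inner_le_norm D (F v)).trans
    (mul_le_mul hD ((hF v).trans (mul_le_mul_of_nonneg_left hv hTF)) (norm_nonneg _) ((norm_nonneg _).trans hD))

/-- **(2.22), the inequality** p. 561: *"|(D_{B̃^{(1)}}φ)(b)·F₁(−A″_b)φ(b₋)| ≦ c₁p(ε)·O(1)e(ε)p(ε)·λ(ε)^{−1/4}p(ε)"* — from
(2.21) `|(D_{B̃}φ)(b)| ≦ c₁p(ε)` (`hDB`), the first-order bound `|F₁(−A″_b)w| ≦ O(1)e(ε)p(ε)|w|` (`hF`) and the small-field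
restriction `|φ(b₋)| ≦ p(ε)/λ(ε)^{1/4}` (`hφ`). [cite: Balaban1982Higgs2, (2.22) p.561] -/
theorem ineq222 (Urep : ℝ → W →ₗ[ℝ] W) (Bt A2 : VecField P j ℝ) (φ : SiteField P j W) (b : PBond P j)
    (F₁ : ℝ → W → W) {c₁ b₀ p e lam O₁ ε : ℝ} {d : ℕ}
    (hcoef : 0 ≤ O₁ * (e * ε ^ (((4 : ℝ) - d) / 2)) * B2.pFn b₀ p ε)
    (hDB : ‖covDerivScalar 1 Urep Bt φ b‖ ≤ c₁ * B2.pFn b₀ p ε)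
    (hF : ∀ w : W, ‖F₁ (-A2 b) w‖ ≤ O₁ * (e * ε ^ (((4 : ℝ) - d) / 2)) * B2.pFn b₀ p ε * ‖w‖)
    (hφ : ‖φ b.src‖ ≤ B2LargeField.thrPhi lam ε d (B2.pFn b₀ p ε)) :
    |⟪covDerivScalar 1 Urep Bt φ b, F₁ (-A2 b) (φ b.src)⟫|
      ≤ c₁ * B2.pFn b₀ p ε
        * (O₁ * (e * ε ^ (((4 : ℝ) - d) / 2)) * B2.pFn b₀ p ε * B2LargeField.thrPhi lam ε d (B2.pFn b₀ p ε)) :=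
  ineq222_abstract (F₁ (-A2 b)) hcoef hDB hF hφ

end Product

/-! ## §2 (2.22), `= O(ε^{κ₀})`: the logarithms lose against `ε^{(4−d)/4}` -/

/-- **The ε-bookkeeping of (2.22)**: with `p(ε) = b₀(1 + log ε⁻¹)ᵖ`, `λ(ε) = λε^{4−d}`, `e(ε) = eε^{(4−d)/2}`, for `d ≦ 3`,
`0 < ε ≦ 1` and any `κ₀ < (4−d)/4` (the interesting case `κ₀ > 0`):
`c₁p(ε)·(O₁e(ε)p(ε)·p(ε)/λ(ε)^{1/4}) = c₁O₁(e/λ^{1/4})·p(ε)³·ε^{(4−d)/4} ≦ c₁O₁(e/λ^{1/4})·b₀³·max{1, 3p/((4−d)/4 − κ₀)}^{3p}·ε^{κ₀}`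
(`one_add_log_inv_rpow_mul_rpow_le` at the exponents `3p` and `(4−d)/4 − κ₀`). [cite: Balaban1982Higgs2, (2.22) p.561] -/
theorem scale222_le {c₁ b₀ p e lam O₁ κ₀ : ℝ} (hc₁ : 0 ≤ c₁) (hb : 0 ≤ b₀) (hp : 0 < p) (he : 0 ≤ e) (hlam : 0 < lam)
    (hO : 0 ≤ O₁) {d : ℕ} (hd : d ≤ 3) (hκ : κ₀ < ((4 : ℝ) - d) / 4) {ε : ℝ} (hε : 0 < ε) (hε1 : ε ≤ 1) :
    c₁ * B2.pFn b₀ p ε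
        * (O₁ * (e * ε ^ (((4 : ℝ) - d) / 2)) * B2.pFn b₀ p ε * B2LargeField.thrPhi lam ε d (B2.pFn b₀ p ε))
      ≤ c₁ * O₁ * (e / lam ^ (1 / 4 : ℝ)) * b₀ ^ 3 * (max 1 (3 * p / (((4 : ℝ) - d) / 4 - κ₀))) ^ (3 * p) * ε ^ κ₀ := by
  have hd' : (d : ℝ) ≤ 3 := by exact_mod_cast hd
  set s : ℝ := ((4 : ℝ) - d) / 4 - κ₀ with hs_def
  have hs : 0 < s := by rw [hs_def]; linarith
  have h3p : 0 < 3 * p := by linarith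
  have key := B2Sect3AGaussianStep.one_add_log_inv_rpow_mul_rpow_le h3p hs hε hε1
  set Lg : ℝ := 1 + Real.log ε⁻¹ with hLg
  have hLg0 : 0 ≤ Lg := by
    rw [hLg, Real.log_inv]
    have := Real.log_nonpos hε.le hε1
    linarith
  have hlamq : 0 < lam ^ (1 / 4 : ℝ) := Real.rpow_pos_of_pos hlam _
  have hroot : (B2LargeField.lambdaEps lam ε d) ^ (1 / 4 : ℝ) = lam ^ (1 / 4 : ℝ) * ε ^ (((4 : ℝ) - d) / 4) := by
    rw [B2LargeField.lambdaEps, Real.mul_rpow hlam.le (zpow_nonneg hε.le _), ← Real.rpow_intCast,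
      ← Real.rpow_mul hε.le]
    congr 2
    push_cast
    ring
  have hε4 : 0 < ε ^ (((4 : ℝ) - d) / 4) := Real.rpow_pos_of_pos hε _
  have hεs : 0 < ε ^ s := Real.rpow_pos_of_pos hε _
  have hεk : 0 < ε ^ κ₀ := Real.rpow_pos_of_pos hε _
  have hsplit2 : ε ^ (((4 : ℝ) - d) / 2) = ε ^ (((4 : ℝ) - d) / 4) * ε ^ (((4 : ℝ) - d) / 4) := by
    rw [← Real.rpow_add hε]; ring_nf
  have hsplit4 : ε ^ (((4 : ℝ) - d) / 4) = ε ^ s * ε ^ κ₀ := by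
    rw [← Real.rpow_add hε, hs_def]; ring_nf
  have hL3 : Lg ^ p * Lg ^ p * Lg ^ p = Lg ^ (3 * p) := by
    rw [← Real.rpow_add' hLg0 (by linarith), ← Real.rpow_add' hLg0 (by linarith)]
    ring_nf
  -- the identity
  have hid : c₁ * B2.pFn b₀ p ε
      * (O₁ * (e * ε ^ (((4 : ℝ) - d) / 2)) * B2.pFn b₀ p ε * B2LargeField.thrPhi lam ε d (B2.pFn b₀ p ε))
      = c₁ * O₁ * (e / lam ^ (1 / 4 : ℝ)) * b₀ ^ 3 * (Lg ^ (3 * p) * ε ^ s) * ε ^ κ₀ := by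
    rw [B2LargeField.thrPhi, B2.pFn, ← hLg, hroot, hsplit2, ← hL3]
    rw [hsplit4]
    field_simp
  rw [hid]
  have hC : 0 ≤ c₁ * O₁ * (e / lam ^ (1 / 4 : ℝ)) * b₀ ^ 3 := by positivity
  calc c₁ * O₁ * (e / lam ^ (1 / 4 : ℝ)) * b₀ ^ 3 * (Lg ^ (3 * p) * ε ^ s) * ε ^ κ₀
      ≤ c₁ * O₁ * (e / lam ^ (1 / 4 : ℝ)) * b₀ ^ 3 * (max 1 (3 * p / s)) ^ (3 * p) * ε ^ κ₀ := by
        apply mul_le_mul_of_nonneg_right _ hεk.le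
        exact mul_le_mul_of_nonneg_left key hC
    _ = c₁ * O₁ * (e / lam ^ (1 / 4 : ℝ)) * b₀ ^ 3 * (max 1 (3 * p / (((4 : ℝ) - d) / 4 - κ₀))) ^ (3 * p) * ε ^ κ₀ := by
        rw [hs_def]

/-- **(2.22), the whole printed chain** p. 561: under (2.21) `|(D_{B̃^{(1)}}φ)(b)| ≦ c₁p(ε)`, the first-order bound
`|F₁(−A″_b)w| ≦ O(1)e(ε)p(ε)|w|` and the restriction `|φ(b₋)| ≦ p(ε)/λ(ε)^{1/4}`, for `d ≦ 3`, `0 < ε ≦ 1` and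
any `κ₀ < (4−d)/4`: `|(D_{B̃^{(1)}}φ)(b)·F₁(−A″_b)φ(b₋)| ≦ C·ε^{κ₀}` with the EXPLICIT ε-independent
`C = c₁O(1)(e/λ^{1/4})b₀³max{1, 3p/((4−d)/4 − κ₀)}^{3p}` — *"= O(ε^{κ₀})"*. [cite: Balaban1982Higgs2, (2.22) p.561] -/
theorem ineq222_printed {P : Params} {j : ℕ} {W : Type*} [NormedAddCommGroup W] [InnerProductSpace ℝ W]
    (Urep : ℝ → W →ₗ[ℝ] W) (Bt A2 : VecField P j ℝ) (φ : SiteField P j W) (b : PBond P j) (F₁ : ℝ → W → W)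
    {c₁ b₀ p e lam O₁ κ₀ ε : ℝ} (hc₁ : 0 ≤ c₁) (hb : 0 ≤ b₀) (hp : 0 < p) (he : 0 ≤ e) (hlam : 0 < lam) (hO : 0 ≤ O₁)
    {d : ℕ} (hd : d ≤ 3) (hκ : κ₀ < ((4 : ℝ) - d) / 4) (hε : 0 < ε) (hε1 : ε ≤ 1)
    (hDB : ‖covDerivScalar 1 Urep Bt φ b‖ ≤ c₁ * B2.pFn b₀ p ε)
    (hF : ∀ w : W, ‖F₁ (-A2 b) w‖ ≤ O₁ * (e * ε ^ (((4 : ℝ) - d) / 2)) * B2.pFn b₀ p ε * ‖w‖)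
    (hφ : ‖φ b.src‖ ≤ B2LargeField.thrPhi lam ε d (B2.pFn b₀ p ε)) :
    |⟪covDerivScalar 1 Urep Bt φ b, F₁ (-A2 b) (φ b.src)⟫|
      ≤ c₁ * O₁ * (e / lam ^ (1 / 4 : ℝ)) * b₀ ^ 3 * (max 1 (3 * p / (((4 : ℝ) - d) / 4 - κ₀))) ^ (3 * p) * ε ^ κ₀ := by
  have hpε : 0 ≤ B2.pFn b₀ p ε := by
    rw [B2.pFn]
    apply mul_nonneg hb
    apply Real.rpow_nonneg
    have := Real.log_nonpos hε.le hε1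
    rw [Real.log_inv]; linarith
  have hcoef : 0 ≤ O₁ * (e * ε ^ (((4 : ℝ) - d) / 2)) * B2.pFn b₀ p ε := by positivity
  exact (ineq222 Urep Bt A2 φ b F₁ hcoef hDB hF hφ).trans (scale222_le hc₁ hb hp he hlam hO hd hκ hε hε1)

end Literature.MathematicalPhysics.QuantumFieldTheory.Balaban1983to89.B2Ineq222Interaction
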